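import Summits.HubbardSuperconductivity.HubbardSuperconductivity.Theorems.FunctionFieldCertificateCertificateSoundness
import Literature.MathematicalPhysics.QuantumLattice.SymbolCertificateEval

/-!
# Route `FunctionFieldCertificate` — what a Hubbard symbol certificate buys (supports stmt-HubbardSuperconductivity-7755)

The construction item `HubbardSymbolCertificate` (stmt-HubbardSuperconductivity-7755, informal in the
route file) asks for an inhabitant of `SymbolCertificate U δ deg p a`
(`Literature.MathematicalPhysics.QuantumLattice.SymbolCertificate`) at a rational point of the window
`U ∈ [4,6]`, `δ ∈ [3/20,1/4]`, with pole order `p ≤ 2` and `a > 0`. This file records, on the literal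
route terms, what such an inhabitant BUYS:

* `certifiedSectorLRO_of_symbolCertificate` — the EVALUATION / SOUNDNESS link of the route
  (`SymbolEvaluation`, stmt-7807, informal): a `SymbolCertificate U δ deg p a` with `U > 0`,
  `δ ∈ (0,1/2)`, `a > 0` yields the route target `CertifiedSectorLRO` (stmt-7330) with the same
  `U, δ, a` and the certificate's own `C, L₀` — the per-`L` matrix identity is the tree's
  `TorusSymbolCertificate.exists_matrix_identity` (file `SymbolCertificateEval.lean`), and
  `hubbardMomentumModel U δ` is literally `hubbardTorus 2 L 1 U`, `L⁻⁴ Δ_dᴴ Δ_d`, `szSector N_L 0`;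
* `hubbardSuperconductivity_of_symbolCertificate` — composed with the tree's
  `certificateSoundness_proof` (stmt-7333): such a certificate proves the summit statement;
* `certifiedSectorLRO_of_hubbardSymbolCertificate`, `hubbardSuperconductivity_of_hubbardSymbolCertificate`
  — the same from the PROPOSED typed form of stmt-7755,
  `∃ U δ : ℚ, U ∈ [4,6] ∧ δ ∈ [3/20,1/4] ∧ ∃ deg p, p ≤ 2 ∧ ∃ a > 0, Nonempty (SymbolCertificate U δ deg p a)`.
  In particular the construction item is at least as strong as `HubbardSuperconductivity` at a fixed
  rational `(U, δ)` of the window.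

Folklore composition of finite-dimensional bookkeeping; no definition is introduced.
-/

set_option linter.dupNamespace false

namespace Summit.HubbardSuperconductivity.HubbardSuperconductivity.Theorems

open Literature.MathematicalPhysics.QuantumLattice
open Summit.HubbardSuperconductivity.HubbardSuperconductivity.Theses.FunctionFieldCertificate

/-- **Evaluation / soundness link for the Hubbard instance** (`SymbolEvaluation`, content of
stmt-HubbardSuperconductivity-7807, supporting stmt-7755): a function-field certificate
`SymbolCertificate U δ deg p a` at a rational point with `U > 0`, `δ ∈ (0,1/2)`, `a > 0` gives the
route target `CertifiedSectorLRO` with the same `U, δ, a` and the certificate's constants `C, L₀`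
(`TorusSymbolCertificate.exists_matrix_identity` at every even `L ≥ L₀`). [folklore] -/
theorem certifiedSectorLRO_of_symbolCertificate {U δ a : ℚ} {deg p : ℕ} (hU : (0 : ℚ) < U)
    (hδ : ((δ : ℚ) : ℝ) ∈ Set.Ioo (0 : ℝ) (1 / 2)) (ha : (0 : ℚ) < a)
    (c : SymbolCertificate U δ deg p a) : CertifiedSectorLRO := by
  refine ⟨(U : ℝ), by exact_mod_cast hU, (δ : ℝ), hδ, (a : ℝ), c.C, by exact_mod_cast ha, c.L₀,
    fun L _ hL hE => ?_⟩
  exact TorusSymbolCertificate.exists_matrix_identity c L hL hE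

/-- **A Hubbard symbol certificate proves the summit**: a `SymbolCertificate U δ deg p a` at any
rational `U > 0`, `δ ∈ (0, 1/2)`, `a > 0` (any `deg`, `p`) gives `HubbardSuperconductivity`, by
`certifiedSectorLRO_of_symbolCertificate` and the tree's soundness theorem `certificateSoundness_proof`
(stmt-7333: soundness in every sector ground state, floor-to-LRO bookkeeping). [folklore] -/
theorem hubbardSuperconductivity_of_symbolCertificate {U δ a : ℚ} {deg p : ℕ} (hU : (0 : ℚ) < U)
    (hδ : ((δ : ℚ) : ℝ) ∈ Set.Ioo (0 : ℝ) (1 / 2)) (ha : (0 : ℚ) < a)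
    (c : SymbolCertificate U δ deg p a) : _root_.HubbardSuperconductivity :=
  (show CertifiedSectorLRO → _root_.HubbardSuperconductivity from certificateSoundness_proof)
    (certifiedSectorLRO_of_symbolCertificate hU hδ ha c)

/-- **What the construction item buys, I** (stmt-HubbardSuperconductivity-7755 in its proposed typed
form ⇒ stmt-7330): if for some rational `U ∈ [4,6]`, `δ ∈ [3/20,1/4]`, some numerator degree `deg`,
pole order `p ≤ 2` and rational `a > 0` the type `SymbolCertificate U δ deg p a` is inhabited, then
`CertifiedSectorLRO` holds (`[3/20,1/4] ⊂ (0,1/2)`, `4 > 0`). [folklore] -/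
theorem certifiedSectorLRO_of_hubbardSymbolCertificate
    (h : ∃ U δ : ℚ, U ∈ Set.Icc (4 : ℚ) 6 ∧ δ ∈ Set.Icc (3 / 20 : ℚ) (1 / 4) ∧
      ∃ deg p : ℕ, p ≤ 2 ∧ ∃ a : ℚ, 0 < a ∧ Nonempty (SymbolCertificate U δ deg p a)) :
    CertifiedSectorLRO := by
  obtain ⟨U, δ, hU, hδ, deg, p, -, a, ha, ⟨c⟩⟩ := h
  refine certifiedSectorLRO_of_symbolCertificate (by linarith [hU.1]) ⟨?_, ?_⟩ ha c
  · have h1 : ((3 / 20 : ℚ) : ℝ) ≤ ((δ : ℚ) : ℝ) := by exact_mod_cast hδ.1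
    linarith [show ((3 / 20 : ℚ) : ℝ) = 3 / 20 by norm_num]
  · have h2 : ((δ : ℚ) : ℝ) ≤ ((1 / 4 : ℚ) : ℝ) := by exact_mod_cast hδ.2
    linarith [show ((1 / 4 : ℚ) : ℝ) = 1 / 4 by norm_num]

/-- **What the construction item buys, II** (stmt-7755 in its proposed typed form ⇒ the summit): a
Hubbard symbol certificate in the window proves `HubbardSuperconductivity`
(`certifiedSectorLRO_of_hubbardSymbolCertificate` and `certificateSoundness_proof`). In particular
the construction item is at least as strong as the summit statement at a fixed rational `(U, δ)`.
[folklore] -/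
theorem hubbardSuperconductivity_of_hubbardSymbolCertificate
    (h : ∃ U δ : ℚ, U ∈ Set.Icc (4 : ℚ) 6 ∧ δ ∈ Set.Icc (3 / 20 : ℚ) (1 / 4) ∧
      ∃ deg p : ℕ, p ≤ 2 ∧ ∃ a : ℚ, 0 < a ∧ Nonempty (SymbolCertificate U δ deg p a)) :
    _root_.HubbardSuperconductivity :=
  (show CertifiedSectorLRO → _root_.HubbardSuperconductivity from certificateSoundness_proof)
    (certifiedSectorLRO_of_hubbardSymbolCertificate h)

end Summit.HubbardSuperconductivity.HubbardSuperconductivity.Theorems
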